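import Mathlib.Analysis.SpecialFunctions.Pow.Integral
import Literature.MathematicalPhysics.QuantumFieldTheory.Balaban1983to89.Beta.AliasingTailDeriv

/-!
# `BalabanUV.Beta.FP.PuncturedCoordDeriv` — road «FP» for binder row D1, leaf H2-P, generic tool for row H2-P-KER's RATE:
# `r` INTEGRATIONS BY PARTS IN ONE COORDINATE of the box Fourier integral for multipliers that are smooth OFF A NULL SET of slices
# (the punctured zone), and INTEGRABILITY on the zone from a power majorant `C·‖s‖^{-α}`, `α < d+1`

HONEST DEPENDENCY (page 1, mandatory): continuum YM on T⁴ ⇐ BetaPertH ∧ nine spine estimates (0/9 proved); BetaPertH ⇐ (D1) ∧ (D4) ∧ CAP+tail;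
G-an2-4 gates asym, D1 and NE2/3/4.  HONEST FRAMING (cell contract, verbatim): «discharging `BetaPertH` makes Bałaban's UV stability UNCONDITIONAL —
a real constructive-QFT result; it is NOT the continuum limit and NOT the Clay problem.»  THIS MODULE DISCHARGES NOTHING of the wall: [folklore] harmonic
analysis on the torus (Katznelson I.4.4 ∕ Grafakos Thm. 3.3.9 (a): `\hat f(n) = (in)^{-j}\widehat{f^{(j)}}(n)`, coordinatewise — the tree's
`Beta.AliasingTailDeriv.fourierBox_coordDeriv` for SMOOTH periodic multipliers) re-run with the slice hypotheses asked only OFF A NULL SET of transverse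
momenta, which is what a multiplier singular at the origin only (road FP: the remainder symbol `B = PinfSym − (2ε)⁻¹𝟙` of H2-P-KER, bounded with
`∂^j B = O(|s|^{-j})`) satisfies; plus the Mathlib integrability of power majorants (`integrableOn_ball_of_norm_le_rpow`).  No `def`, no `def … : Prop`,
nothing cited as a hypothesis, 0 sorry; 0 wall binders; NOT D1, NOT BetaPertH, NOT continuum, NOT Clay.  «not in print as used here; our bookkeeping».

ABSOLUTE RULE (cell charter, verbatim): «No internally-minted statement may enter as a cited fact. Every hypothesis is either kernel-proved in this package or a
verbatim quotation of a PUBLISHED theorem with page reference. The manuscript(s) under audit are NOT citable for their own disputed steps — they are the thing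
under adjudication; programme-internal (2001/route/tribunal) claims are never citable.»

WHAT (lattice dimension `d + 1`, coordinate `i`, slices `t ↦ i.insertNth t q`, `q ∈ [−π,π]^d` the transverse momentum):
* §0 [folklore] `integral_deriv_mul_char_Ioo`, `integral_iteratedDeriv_mul_char_Ioo` — the tree's 1-D integration by parts against `e^{itn}` with periodic
  boundary VALUES (`AliasingTailDeriv.integral_deriv_mul_char`), the derivative asked only on the OPEN interval `(−π, π)` (Mathlib
  `integral_mul_deriv_eq_deriv_mul_of_hasDerivAt`): continuity on `[−π,π]` + equal endpoint values suffice at `±π`.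
* §1 **`fourierBox_coordDeriv_off_null`** — if `F 0, …, F r` have integrable box integrands and, for every transverse `q ∈ BZ d` OUTSIDE a set `N` with
  `volume N = 0`, are successive `i`-th derivatives along the OPEN real coordinate line (each continuous on `[−π,π]` with equal endpoint values), then
  `fourierBox (F r) x = (−i x_i)^r · fourierBox (F 0) x` (the slices through `N` are invisible to Fubini); `latticeKernel_coordDeriv_off_null` (same for
  `latticeKernel`); the typical use is `N = {0}` (`volume_singleton`), i.e. a multiplier singular at the origin of the zone only.
* §2 **`norm_latticeKernel_le_of_coordDeriv_off_null`** — hence `|x_i|^r · ‖latticeKernel (F 0) x‖ ≤ (2π)^{-(d+1)} · ∫_{BZ} ‖F r (ofRealVec s)‖ ds`: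
  POWER-LAW DECAY `‖K(x)‖ ≤ ‖F r‖_{L¹}/((2π)^{d+1}|x_i|^r)` of the lattice kernel from `r` integrable derivatives (no strip, no holomorphy).
* §3 **`integrableOn_BZ_of_norm_le_mul_norm_rpow_neg`** — a function continuous on the punctured zone with `‖f s‖ ≤ C·‖s‖^{−α}` (`s ≠ 0`, `α < d+1`, sup norm)
  is integrable on `BZ (d+1)` (Mathlib `integrableOn_ball_of_norm_le_rpow` on the ball of radius 4 ⊇ the zone); `integrableOn_integrand_of_norm_le_mul_norm_rpow_neg`
  (the same for the box integrand `G(ofRealVec s)·e^{is·x}` of a multiplier so majorised) — the integrability currency of §1–§2 for symbols of class `O(|s|^{-j})`,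
  `j ≤ d`.
* §4 **`norm_latticeKernel_le_div_supNorm_pow`** — with such a chain in EVERY coordinate and `‖F μ r‖_{L¹(BZ)} ≤ L`: `‖latticeKernel G x‖ ≤ (2π)^{-(d+1)}·L/‖x‖_∞^r`
  (`x ≠ 0`; Grafakos' choice `|x_μ| = ‖x‖_∞`).
* §5 `phase_add`, `phase_single`, `phase_add_single`, `integrand_cexp_mul`, `latticeKernel_cexp_mul`, **`latticeKernel_fwdDiff`** — `latticeKernel ((e^{ip_j} − 1)·G) x = latticeKernel G (x + e_j) −
  latticeKernel G x`: GRADED (differenced) decay of a kernel = §1–§4 applied to the differenced symbol, one order better at `p = 0`.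
Provenance: G-an2-4 swarm leaf prover 05, gen 34 (prover-b2b-balaban-gan24-formalise-leaf-05-g34-0), cross-lane on road FP, 2026-08-20.
-/

noncomputable section

namespace Summit.QuantumFields.BalabanUV.Beta.FP.PuncturedCoordDeriv

open MeasureTheory Set Complex Filter Topology
open scoped Real
open Literature.MathematicalPhysics.QuantumFieldTheory.Balaban1983to89
open B4Strip (ofRealVec)
open B4ContourShift (BZ phase integrand fourierBox latticeKernel fourierBox_eq_iterated ofRealVec_insertNth phase_insertNth norm_cexp_phase)

variable {d : ℕ}

/-! ## §0 One-dimensional integration by parts against a character, INTERIOR derivatives only -/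

/-- [folklore] the character `t ↦ e^{i t n}` has derivative `i n e^{i t n}`. -/
theorem hasDerivAt_cexp_char (n : ℤ) (t : ℝ) :
    HasDerivAt (fun s : ℝ => cexp (I * (s : ℂ) * n)) (I * n * cexp (I * (t : ℂ) * n)) t := by
  have h1 : HasDerivAt (fun s : ℝ => I * (s : ℂ) * n) (I * 1 * n) t := by
    have := (hasDerivAt_id t).ofReal_comp
    simpa using ((this.const_mul I).mul_const (n : ℂ))
  have h2 := h1.cexp
  simpa [mul_comm, mul_left_comm, mul_assoc] using h2

/-- [folklore] `e^{iπn} = e^{-iπn}` for an integer `n`. -/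
theorem cexp_pi_char_eq (n : ℤ) : cexp (I * (π : ℂ) * n) = cexp (I * ((-π : ℝ) : ℂ) * n) := by
  have h : I * (π : ℂ) * n = I * ((-π : ℝ) : ℂ) * n + n * (2 * π * I) := by push_cast; ring
  rw [h, Complex.exp_add, Complex.exp_int_mul_two_pi_mul_I, mul_one]

/-- [folklore] INTEGRATION BY PARTS on `[-π, π]` against `e^{itn}` with periodic boundary VALUES and the derivative asked only in the OPEN interval
(`AliasingTailDeriv.integral_deriv_mul_char` asks it on the closed one): `f` continuous on `[-π,π]`, `HasDerivAt f (f' t) t` for `t ∈ (-π, π)`,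
`f'` interval-integrable, `f (-π) = f π` ⟹ `∫ f' e^{itn} = -(in) ∫ f e^{itn}`. -/
theorem integral_deriv_mul_char_Ioo {f f' : ℝ → ℂ} {n : ℤ} (hfc : ContinuousOn f (Set.uIcc (-π) π))
    (hf : ∀ t ∈ Set.Ioo (-π) π, HasDerivAt f (f' t) t)
    (hf'i : IntervalIntegrable f' MeasureTheory.volume (-π) π) (hper : f (-π) = f π) :
    (∫ t in (-π)..π, f' t * cexp (I * (t : ℂ) * n)) = -(I * n) * ∫ t in (-π)..π, f t * cexp (I * (t : ℂ) * n) := by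
  have hππ : -π ≤ π := by linarith [Real.pi_pos]
  have hv : ∀ t ∈ Set.Ioo (min (-π) π) (max (-π) π),
      HasDerivAt (fun s : ℝ => cexp (I * (s : ℂ) * n)) (I * n * cexp (I * (t : ℂ) * n)) t :=
    fun t _ => hasDerivAt_cexp_char n t
  have hu : ∀ t ∈ Set.Ioo (min (-π) π) (max (-π) π), HasDerivAt f (f' t) t := by
    intro t ht; rw [min_eq_left hππ, max_eq_right hππ] at ht; exact hf t ht
  have hvc : ContinuousOn (fun s : ℝ => cexp (I * (s : ℂ) * n)) (Set.uIcc (-π) π) := Continuous.continuousOn (by fun_prop)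
  have hv'i : IntervalIntegrable (fun t : ℝ => I * n * cexp (I * (t : ℂ) * n)) MeasureTheory.volume (-π) π :=
    (Continuous.continuousOn (by fun_prop)).intervalIntegrable
  have hparts := intervalIntegral.integral_mul_deriv_eq_deriv_mul_of_hasDerivAt hfc hvc hu hv hf'i hv'i
  have hb : f π * cexp (I * (π : ℝ) * n) - f (-π) * cexp (I * ((-π : ℝ) : ℂ) * n) = 0 := by
    rw [hper, show ((π : ℝ) : ℂ) = (π : ℂ) from rfl, cexp_pi_char_eq n]; ring
  have hlhs : (∫ t in (-π)..π, f t * (I * n * cexp (I * (t : ℂ) * n)))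
      = (I * n) * ∫ t in (-π)..π, f t * cexp (I * (t : ℂ) * n) := by
    rw [← intervalIntegral.integral_const_mul]
    congr 1; funext t; ring
  rw [hlhs] at hparts
  have : (I * n) * (∫ t in (-π)..π, f t * cexp (I * (t : ℂ) * n)) = -(∫ t in (-π)..π, f' t * cexp (I * (t : ℂ) * n)) := by
    rw [hparts, hb, zero_sub]
  rw [← neg_neg (∫ t in (-π)..π, f' t * cexp (I * (t : ℂ) * n)), ← this]; ring

/-- [folklore] ITERATED, interior derivatives: `F 0, …, F r` continuous on `[-π,π]`, `HasDerivAt (F j) (F (j+1) t) t` on `(-π, π)` for `j < r`, periodic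
endpoint values for `j < r` ⟹ `∫ F r · e^{itn} = (-(in))^r ∫ F 0 · e^{itn}`. -/
theorem integral_iteratedDeriv_mul_char_Ioo {n : ℤ} (r : ℕ) (F : ℕ → ℝ → ℂ)
    (hF : ∀ j < r, ∀ t ∈ Set.Ioo (-π) π, HasDerivAt (F j) (F (j + 1) t) t)
    (hFc : ∀ j ≤ r, ContinuousOn (F j) (Set.uIcc (-π) π)) (hper : ∀ j < r, F j (-π) = F j π) :
    (∫ t in (-π)..π, F r t * cexp (I * (t : ℂ) * n)) = (-(I * n)) ^ r * ∫ t in (-π)..π, F 0 t * cexp (I * (t : ℂ) * n) := by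
  induction r with
  | zero => simp
  | succ r ih =>
    have h1 := integral_deriv_mul_char_Ioo (f := F r) (f' := F (r + 1)) (n := n) (hFc r (Nat.le_succ r)) (hF r (Nat.lt_succ_self r))
      ((hFc (r + 1) le_rfl).intervalIntegrable) (hper r (Nat.lt_succ_self r))
    rw [h1, ih (fun j hj => hF j (Nat.lt_succ_of_lt hj)) (fun j hj => hFc j (Nat.le_succ_of_le hj))
      (fun j hj => hper j (Nat.lt_succ_of_lt hj))]
    ring

/-! ## §1 `r` integrations by parts in one coordinate, slice hypotheses OFF a null set -/

/-- [folklore] **`r`-FOLD INTEGRATION BY PARTS IN THE COORDINATE `i`, OFF A NULL SET OF SLICES**: as `AliasingTailDeriv.fourierBox_coordDeriv`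
(Grafakos (3.3.9)), but the derivative ∕ continuity ∕ periodicity hypotheses on the slices `t ↦ F j (i.insertNth t q)` are asked only for transverse
momenta `q ∈ BZ d ∖ N` with `volume N = 0` — enough for a multiplier that is smooth on the zone minus the origin (`N = {0}`). -/
theorem fourierBox_coordDeriv_off_null (i : Fin (d + 1)) (r : ℕ) (F : ℕ → (Fin (d + 1) → ℂ) → ℂ) (x : Fin (d + 1) → ℤ)
    (N : Set (Fin d → ℝ)) (hN : volume N = 0)
    (hint : ∀ j ≤ r, IntegrableOn (integrand (F j) x) (BZ (d + 1)))
    (hder : ∀ j < r, ∀ q ∈ BZ d, q ∉ N → ∀ t ∈ Set.Ioo (-π) π,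
      HasDerivAt (fun s : ℝ => F j (i.insertNth (s : ℂ) (ofRealVec q))) (F (j + 1) (i.insertNth (t : ℂ) (ofRealVec q))) t)
    (hcont : ∀ j ≤ r, ∀ q ∈ BZ d, q ∉ N → ContinuousOn (fun s : ℝ => F j (i.insertNth (s : ℂ) (ofRealVec q))) (Set.uIcc (-π) π))
    (hper : ∀ j < r, ∀ q ∈ BZ d, q ∉ N →
      F j (i.insertNth (((-π : ℝ)) : ℂ) (ofRealVec q)) = F j (i.insertNth ((π : ℝ) : ℂ) (ofRealVec q))) :
    fourierBox (F r) x = (-(I * x i)) ^ r * fourierBox (F 0) x := by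
  have hBZ : MeasurableSet (BZ d) := by unfold BZ; exact measurableSet_Icc
  rw [fourierBox_eq_iterated (F r) x i (hint r le_rfl), fourierBox_eq_iterated (F 0) x i (hint 0 (Nat.zero_le _)),
    ← MeasureTheory.integral_const_mul]
  -- the two iterated integrands agree at every `q ∈ BZ d ∖ N`, hence a.e. on `BZ d`
  have hae : ∀ᵐ q ∂(volume : Measure (Fin d → ℝ)), q ∉ N := measure_eq_zero_iff_ae_notMem.mp hN
  refine setIntegral_congr_ae hBZ (hae.mono fun q hqN hq => ?_)
  set C : ℂ := cexp (I * phase q (fun j => x (i.succAbove j))) with hC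
  have hI : ∀ j, (∫ t in Icc (-π) π, integrand (F j) x (i.insertNth t q))
      = ∫ t in (-π)..π, (F j (i.insertNth (t : ℂ) (ofRealVec q)) * C) * cexp (I * (t : ℂ) * (x i)) := by
    intro j
    rw [intervalIntegral.integral_of_le (by linarith [Real.pi_pos] : -π ≤ π), integral_Icc_eq_integral_Ioc]
    refine setIntegral_congr_fun measurableSet_Ioc fun t _ => ?_
    simp only [integrand, ofRealVec_insertNth, phase_insertNth, mul_add, Complex.exp_add, hC]
    ring
  rw [hI r, hI 0]
  have key := integral_iteratedDeriv_mul_char_Ioo (n := x i) r (fun j t => F j (i.insertNth (t : ℂ) (ofRealVec q)) * C)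
    (fun j hj t ht => (hder j hj q hq hqN t ht).mul_const C)
    (fun j hj => (hcont j hj q hq hqN).mul continuousOn_const)
    (fun j hj => by simp only [hper j hj q hq hqN])
  simpa using key

/-- [folklore] the same identity for the normalised lattice kernel: `latticeKernel (F r) x = (−i x_i)^r · latticeKernel (F 0) x`. -/
theorem latticeKernel_coordDeriv_off_null (i : Fin (d + 1)) (r : ℕ) (F : ℕ → (Fin (d + 1) → ℂ) → ℂ) (x : Fin (d + 1) → ℤ)
    (N : Set (Fin d → ℝ)) (hN : volume N = 0)
    (hint : ∀ j ≤ r, IntegrableOn (integrand (F j) x) (BZ (d + 1)))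
    (hder : ∀ j < r, ∀ q ∈ BZ d, q ∉ N → ∀ t ∈ Set.Ioo (-π) π,
      HasDerivAt (fun s : ℝ => F j (i.insertNth (s : ℂ) (ofRealVec q))) (F (j + 1) (i.insertNth (t : ℂ) (ofRealVec q))) t)
    (hcont : ∀ j ≤ r, ∀ q ∈ BZ d, q ∉ N → ContinuousOn (fun s : ℝ => F j (i.insertNth (s : ℂ) (ofRealVec q))) (Set.uIcc (-π) π))
    (hper : ∀ j < r, ∀ q ∈ BZ d, q ∉ N →
      F j (i.insertNth (((-π : ℝ)) : ℂ) (ofRealVec q)) = F j (i.insertNth ((π : ℝ) : ℂ) (ofRealVec q))) :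
    latticeKernel (F r) x = (-(I * x i)) ^ r * latticeKernel (F 0) x := by
  have hb := fourierBox_coordDeriv_off_null i r F x N hN hint hder hcont hper
  simp only [latticeKernel, hb, Complex.real_smul]
  ring

/-! ## §2 Power-law decay of the lattice kernel from `r` integrable derivatives -/

/-- [folklore] `‖fourierBox G x‖ ≤ ∫_{BZ} ‖G (ofRealVec s)‖ ds` (`‖e^{is·x}‖ = 1`). -/
theorem norm_fourierBox_le_integral_norm (G : (Fin (d + 1) → ℂ) → ℂ) (x : Fin (d + 1) → ℤ) :
    ‖fourierBox G x‖ ≤ ∫ s in BZ (d + 1), ‖G (ofRealVec s)‖ := by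
  unfold fourierBox
  refine (norm_integral_le_integral_norm _).trans (le_of_eq ?_)
  refine setIntegral_congr_fun (by unfold BZ; exact measurableSet_Icc) fun s _ => ?_
  show ‖integrand G x s‖ = ‖G (ofRealVec s)‖
  unfold integrand
  rw [norm_mul, norm_cexp_phase, mul_one]

/-- [folklore] **POWER-LAW DECAY OF THE LATTICE KERNEL FROM `r` INTEGRABLE DERIVATIVES IN ONE COORDINATE** (off a null set of slices):
`|x_i|^r · ‖latticeKernel (F 0) x‖ ≤ (2π)^{-(d+1)} · ∫_{BZ} ‖F r (ofRealVec s)‖ ds`. -/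
theorem norm_latticeKernel_le_of_coordDeriv_off_null (i : Fin (d + 1)) (r : ℕ) (F : ℕ → (Fin (d + 1) → ℂ) → ℂ) (x : Fin (d + 1) → ℤ)
    (N : Set (Fin d → ℝ)) (hN : volume N = 0)
    (hint : ∀ j ≤ r, IntegrableOn (integrand (F j) x) (BZ (d + 1)))
    (hder : ∀ j < r, ∀ q ∈ BZ d, q ∉ N → ∀ t ∈ Set.Ioo (-π) π,
      HasDerivAt (fun s : ℝ => F j (i.insertNth (s : ℂ) (ofRealVec q))) (F (j + 1) (i.insertNth (t : ℂ) (ofRealVec q))) t)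
    (hcont : ∀ j ≤ r, ∀ q ∈ BZ d, q ∉ N → ContinuousOn (fun s : ℝ => F j (i.insertNth (s : ℂ) (ofRealVec q))) (Set.uIcc (-π) π))
    (hper : ∀ j < r, ∀ q ∈ BZ d, q ∉ N →
      F j (i.insertNth (((-π : ℝ)) : ℂ) (ofRealVec q)) = F j (i.insertNth ((π : ℝ) : ℂ) (ofRealVec q))) :
    |(x i : ℝ)| ^ r * ‖latticeKernel (F 0) x‖ ≤ ((2 * π) ^ (d + 1))⁻¹ * ∫ s in BZ (d + 1), ‖F r (ofRealVec s)‖ := by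
  have hK := latticeKernel_coordDeriv_off_null i r F x N hN hint hder hcont hper
  have hn : ‖latticeKernel (F r) x‖ = |(x i : ℝ)| ^ r * ‖latticeKernel (F 0) x‖ := by
    rw [hK, norm_mul, norm_pow, norm_neg, norm_mul, Complex.norm_I, one_mul, Complex.norm_intCast]
  rw [← hn]
  have hpos : (0 : ℝ) < (2 * π) ^ (d + 1) := by positivity
  unfold latticeKernel
  rw [norm_smul, Real.norm_eq_abs, abs_of_pos (inv_pos.mpr hpos)]
  exact mul_le_mul_of_nonneg_left (norm_fourierBox_le_integral_norm (F r) x) (inv_pos.mpr hpos).le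

/-- [folklore] … read as a bound on the kernel at `x` with `x_i ≠ 0`: `‖latticeKernel (F 0) x‖ ≤ (2π)^{-(d+1)}·‖F r‖_{L¹(BZ)} / |x_i|^r`. -/
theorem norm_latticeKernel_le_div_of_coordDeriv_off_null (i : Fin (d + 1)) (r : ℕ) (F : ℕ → (Fin (d + 1) → ℂ) → ℂ)
    (x : Fin (d + 1) → ℤ) (hx : x i ≠ 0) (N : Set (Fin d → ℝ)) (hN : volume N = 0)
    (hint : ∀ j ≤ r, IntegrableOn (integrand (F j) x) (BZ (d + 1)))
    (hder : ∀ j < r, ∀ q ∈ BZ d, q ∉ N → ∀ t ∈ Set.Ioo (-π) π,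
      HasDerivAt (fun s : ℝ => F j (i.insertNth (s : ℂ) (ofRealVec q))) (F (j + 1) (i.insertNth (t : ℂ) (ofRealVec q))) t)
    (hcont : ∀ j ≤ r, ∀ q ∈ BZ d, q ∉ N → ContinuousOn (fun s : ℝ => F j (i.insertNth (s : ℂ) (ofRealVec q))) (Set.uIcc (-π) π))
    (hper : ∀ j < r, ∀ q ∈ BZ d, q ∉ N →
      F j (i.insertNth (((-π : ℝ)) : ℂ) (ofRealVec q)) = F j (i.insertNth ((π : ℝ) : ℂ) (ofRealVec q))) :
    ‖latticeKernel (F 0) x‖ ≤ ((2 * π) ^ (d + 1))⁻¹ * (∫ s in BZ (d + 1), ‖F r (ofRealVec s)‖) / |(x i : ℝ)| ^ r := by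
  have h := norm_latticeKernel_le_of_coordDeriv_off_null i r F x N hN hint hder hcont hper
  have hpos : 0 < |(x i : ℝ)| ^ r := pow_pos (abs_pos.mpr (by exact_mod_cast hx)) r
  rw [le_div_iff₀ hpos, mul_comm]
  exact h

/-! ## §3 Integrability on the zone from a power majorant off the origin -/

/-- [folklore] the zone lies in the open sup-norm ball of radius `4`. -/
theorem BZ_subset_ball : BZ (d + 1) ⊆ Metric.ball (0 : Fin (d + 1) → ℝ) 4 := by
  intro s hs
  rw [Metric.mem_ball, dist_zero_right, pi_norm_lt_iff (by norm_num)]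
  intro μ
  rw [Real.norm_eq_abs, abs_lt]
  have h1 := hs.1 μ; have h2 := hs.2 μ
  simp only at h1 h2
  constructor <;> linarith [Real.pi_lt_four, Real.pi_pos]

/-- [folklore] **INTEGRABILITY ON THE ZONE FROM A POWER MAJORANT**: a function `f` continuous on `BZ (d+1) ∖ {0}` with `‖f s‖ ≤ C·‖s‖^{−α}` for
`s ≠ 0` in the zone, `0 ≤ C`, `α < d + 1` (sup norm), is integrable on `BZ (d+1)` (the origin is null; Mathlib's
`integrableOn_ball_of_norm_le_rpow` on the ball of radius `4` applied to the zero extension). -/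
theorem integrableOn_BZ_of_norm_le_mul_norm_rpow_neg {E : Type*} [NormedAddCommGroup E] {f : (Fin (d + 1) → ℝ) → E} {C α : ℝ}
    (hC : 0 ≤ C) (hα : α < (d : ℝ) + 1) (hcont : ContinuousOn f (BZ (d + 1) \ {0}))
    (hB : ∀ s ∈ BZ (d + 1), s ≠ 0 → ‖f s‖ ≤ C * ‖s‖ ^ (-α)) :
    IntegrableOn f (BZ (d + 1)) volume := by
  have hBZ : MeasurableSet (BZ (d + 1)) := by unfold BZ; exact measurableSet_Icc
  have hmeas : MeasurableSet (BZ (d + 1) \ {0}) := hBZ.diff (measurableSet_singleton 0)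
  set g : (Fin (d + 1) → ℝ) → E := (BZ (d + 1) \ {0}).indicator f with hg
  -- `g` is a.e.-strongly measurable and majorised everywhere
  have hgm : AEStronglyMeasurable g volume :=
    (aestronglyMeasurable_indicator_iff hmeas).mpr (hcont.aestronglyMeasurable hmeas)
  have hgb : ∀ s, ‖g s‖ ≤ C * ‖s‖ ^ (-α) := by
    intro s
    by_cases hs : s ∈ BZ (d + 1) \ {0}
    · rw [hg, indicator_of_mem hs]; exact hB s hs.1 (fun h => hs.2 h)
    · rw [hg, indicator_of_notMem hs, norm_zero]; exact mul_nonneg hC (Real.rpow_nonneg (norm_nonneg _) _)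
  have hrank : Module.finrank ℝ (Fin (d + 1) → ℝ) = d + 1 := by simp
  have hball : IntegrableOn g (Metric.ball (0 : Fin (d + 1) → ℝ) 4) volume :=
    integrableOn_ball_of_norm_le_rpow (μ := volume) (by rw [hrank]; omega) (by rw [hrank]; exact_mod_cast hα)
      (Eventually.of_forall hgb) hgm
  have hgBZ : IntegrableOn g (BZ (d + 1)) volume := hball.mono_set BZ_subset_ball
  -- `f = g` on `BZ ∖ {0}`, which is a.e. all of `BZ`
  have h1 : IntegrableOn f (BZ (d + 1) \ {0}) volume :=
    (hgBZ.mono_set fun s hs => hs.1).congr_fun (fun s hs => by rw [hg, indicator_of_mem hs]) hmeas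
  have h0 : volume ({0} : Set (Fin (d + 1) → ℝ)) = 0 := measure_singleton 0
  exact h1.congr_set_ae (sdiff_null_ae_eq_self h0).symm

/-- [folklore] … for the box integrand of a multiplier: if `s ↦ G (ofRealVec s)` is continuous on the punctured zone with
`‖G (ofRealVec s)‖ ≤ C·‖s‖^{−α}` (`s ≠ 0`, `α < d+1`), then `integrand G x` is integrable on `BZ (d+1)` for every `x`. -/
theorem integrableOn_integrand_of_norm_le_mul_norm_rpow_neg {G : (Fin (d + 1) → ℂ) → ℂ} {C α : ℝ}
    (hC : 0 ≤ C) (hα : α < (d : ℝ) + 1) (hcont : ContinuousOn (fun s : Fin (d + 1) → ℝ => G (ofRealVec s)) (BZ (d + 1) \ {0}))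
    (hB : ∀ s ∈ BZ (d + 1), s ≠ 0 → ‖G (ofRealVec s)‖ ≤ C * ‖s‖ ^ (-α)) (x : Fin (d + 1) → ℤ) :
    IntegrableOn (integrand G x) (BZ (d + 1)) volume := by
  have hph : Continuous fun s : Fin (d + 1) → ℝ => cexp (I * phase s x) := by
    unfold phase
    exact (continuous_const.mul (continuous_finsetSum _ fun μ _ =>
      (Complex.continuous_ofReal.comp (continuous_apply μ)).mul continuous_const)).cexp
  have hf := integrableOn_BZ_of_norm_le_mul_norm_rpow_neg hC hα hcont hB
  unfold integrand
  exact hf.mul_bdd (c := 1) hph.aestronglyMeasurable (Eventually.of_forall fun s => (norm_cexp_phase s x).le)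

/-! ## §4 Sup-norm decay from a punctured derivative chain in EVERY coordinate -/

/-- [folklore] **SUP-NORM POWER-LAW DECAY** (Grafakos: «pick a `j` such that `|m_j| = sup_k |m_k|`»): with a punctured derivative chain of length `r` in
EVERY coordinate (`F μ 0 = G`) and a common bound `L` for the `L¹(BZ)` norms of the last members, `‖latticeKernel G x‖ ≤ (2π)^{-(d+1)}·L / ‖x‖_∞^r`
for every `x ≠ 0` (`‖x‖_∞ = B4ContourShift.supNorm x`). -/
theorem norm_latticeKernel_le_div_supNorm_pow {G : (Fin (d + 1) → ℂ) → ℂ} (r : ℕ) (F : Fin (d + 1) → ℕ → (Fin (d + 1) → ℂ) → ℂ)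
    (hF0 : ∀ μ, F μ 0 = G) (N : Set (Fin d → ℝ)) (hN : volume N = 0)
    (hint : ∀ μ, ∀ j ≤ r, ∀ x, IntegrableOn (integrand (F μ j) x) (BZ (d + 1)))
    (hder : ∀ μ, ∀ j < r, ∀ q ∈ BZ d, q ∉ N → ∀ t ∈ Set.Ioo (-π) π,
      HasDerivAt (fun s : ℝ => F μ j (μ.insertNth (s : ℂ) (ofRealVec q))) (F μ (j + 1) (μ.insertNth (t : ℂ) (ofRealVec q))) t)
    (hcont : ∀ μ, ∀ j ≤ r, ∀ q ∈ BZ d, q ∉ N → ContinuousOn (fun s : ℝ => F μ j (μ.insertNth (s : ℂ) (ofRealVec q))) (Set.uIcc (-π) π))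
    (hper : ∀ μ, ∀ j < r, ∀ q ∈ BZ d, q ∉ N →
      F μ j (μ.insertNth (((-π : ℝ)) : ℂ) (ofRealVec q)) = F μ j (μ.insertNth ((π : ℝ) : ℂ) (ofRealVec q)))
    {L : ℝ} (hL : ∀ μ, ∫ s in BZ (d + 1), ‖F μ r (ofRealVec s)‖ ≤ L) (x : Fin (d + 1) → ℤ) (hx : x ≠ 0) :
    ‖latticeKernel G x‖ ≤ ((2 * π) ^ (d + 1))⁻¹ * L / B4ContourShift.supNorm x ^ r := by
  -- the coordinate realising the sup norm
  obtain ⟨μ, -, hμ⟩ := Finset.exists_mem_eq_sup' (Finset.univ_nonempty (α := Fin (d + 1))) (fun i => ((|x i| : ℤ) : ℝ))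
  have hsup : B4ContourShift.supNorm x = |(x μ : ℝ)| := by
    unfold B4ContourShift.supNorm; rw [hμ, Int.cast_abs]
  -- `x μ ≠ 0`: otherwise every coordinate vanishes
  have hxμ : x μ ≠ 0 := by
    intro h0
    apply hx
    funext i
    have hle : ((|x i| : ℤ) : ℝ) ≤ ((|x μ| : ℤ) : ℝ) := by
      rw [← hμ]; exact Finset.le_sup' (fun i => ((|x i| : ℤ) : ℝ)) (Finset.mem_univ i)
    rw [h0, abs_zero, Int.cast_zero] at hle
    have : |x i| ≤ 0 := by exact_mod_cast hle
    exact abs_nonpos_iff.mp this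
  have h := norm_latticeKernel_le_div_of_coordDeriv_off_null μ r (F μ) x hxμ N hN (fun j hj => hint μ j hj x) (hder μ) (hcont μ) (hper μ)
  rw [hF0 μ] at h
  rw [hsup]
  have hpos : 0 < |(x μ : ℝ)| ^ r := pow_pos (abs_pos.mpr (by exact_mod_cast hxμ)) r
  have hc : (0 : ℝ) ≤ ((2 * π) ^ (d + 1))⁻¹ := by positivity
  refine h.trans ?_
  exact div_le_div_of_nonneg_right (mul_le_mul_of_nonneg_left (hL μ) hc) hpos.le

/-! ## §5 Forward differences of a lattice kernel = phase factors on the symbol -/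

/-- [folklore] the phase is additive in the lattice point. -/
theorem phase_add (s : Fin (d + 1) → ℝ) (x y : Fin (d + 1) → ℤ) : phase s (x + y) = phase s x + phase s y := by
  unfold phase
  rw [← Finset.sum_add_distrib]
  refine Finset.sum_congr rfl fun μ _ => ?_
  rw [Pi.add_apply, Int.cast_add, mul_add]

/-- [folklore] the phase at the unit vector `e_j` is `s_j`. -/
theorem phase_single (s : Fin (d + 1) → ℝ) (j : Fin (d + 1)) : phase s (Pi.single j (1 : ℤ)) = (s j : ℂ) := by
  unfold phase
  rw [Finset.sum_eq_single j]
  · simp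
  · intro μ _ hμ; simp [hμ]
  · intro h; exact absurd (Finset.mem_univ j) h

/-- [folklore] the phase at a shifted lattice point: `phase s (x + e_j) = phase s x + s_j`. -/
theorem phase_add_single (s : Fin (d + 1) → ℝ) (x : Fin (d + 1) → ℤ) (j : Fin (d + 1)) :
    phase s (x + Pi.single j 1) = phase s x + (s j : ℂ) := by
  rw [phase_add, phase_single]

/-- [folklore] multiplying the symbol by the coordinate phase `e^{i p_j}` SHIFTS the box integrand: `integrand (e^{ip_j}·G) x = integrand G (x + e_j)`. -/
theorem integrand_cexp_mul (G : (Fin (d + 1) → ℂ) → ℂ) (j : Fin (d + 1)) (x : Fin (d + 1) → ℤ) :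
    integrand (fun p => cexp (I * p j) * G p) x = integrand G (x + Pi.single j 1) := by
  funext s
  unfold integrand
  rw [phase_add_single, mul_add, Complex.exp_add]
  simp only [ofRealVec]
  ring

/-- [folklore] … hence `latticeKernel (e^{ip_j}·G) x = latticeKernel G (x + e_j)` (no integrability needed: both sides are the same integral). -/
theorem latticeKernel_cexp_mul (G : (Fin (d + 1) → ℂ) → ℂ) (j : Fin (d + 1)) (x : Fin (d + 1) → ℤ) :
    latticeKernel (fun p => cexp (I * p j) * G p) x = latticeKernel G (x + Pi.single j 1) := by
  unfold latticeKernel fourierBox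
  rw [integrand_cexp_mul]

/-- [folklore] **FORWARD DIFFERENCES OF A LATTICE KERNEL ARE KERNELS OF THE DIFFERENCED SYMBOL**: `latticeKernel ((e^{ip_j} − 1)·G) x =
latticeKernel G (x + e_j) − latticeKernel G x` (integrable box integrands) — so the graded decay of `K_G` is the decay of the kernel of the symbol
`(e^{ip_j} − 1)·G(p)`, one order better at `p = 0`, to which §1–§4 apply with one more integration by parts. -/
theorem latticeKernel_fwdDiff (G : (Fin (d + 1) → ℂ) → ℂ) (j : Fin (d + 1)) (x : Fin (d + 1) → ℤ)
    (hint : IntegrableOn (integrand G x) (BZ (d + 1))) (hint' : IntegrableOn (integrand G (x + Pi.single j 1)) (BZ (d + 1))) :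
    latticeKernel (fun p => (cexp (I * p j) - 1) * G p) x = latticeKernel G (x + Pi.single j 1) - latticeKernel G x := by
  have hsplit : (fun p : Fin (d + 1) → ℂ => (cexp (I * p j) - 1) * G p) = fun p => cexp (I * p j) * G p - G p := by
    funext p; ring
  rw [hsplit]
  have hI : integrand (fun p => cexp (I * p j) * G p - G p) x = fun s => integrand (fun p => cexp (I * p j) * G p) x s - integrand G x s := by
    funext s; unfold integrand; ring
  have h1 : IntegrableOn (integrand (fun p => cexp (I * p j) * G p) x) (BZ (d + 1)) := by rw [integrand_cexp_mul]; exact hint'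
  unfold latticeKernel fourierBox
  rw [hI, integral_sub h1 hint, smul_sub, ← integrand_cexp_mul]

end Summit.QuantumFields.BalabanUV.Beta.FP.PuncturedCoordDeriv

end
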